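import Summits.AtomisticToContinuum.Crystallization.Theses.IsometryAtoms
import Literature.MathematicalPhysics.StatisticalMechanics.BarlowStacking
import Literature.MathematicalPhysics.StatisticalMechanics.HcpHomogeneous
import Summits.AtomisticToContinuum.Crystallization.Theorems.PalmUnimodularRigidityMinimiserShellsMeckePricing
import Summits.AtomisticToContinuum.Crystallization.Theorems.IsometryAtomsMinimisingLawsHaveAtomsHcpPatchRigid
import Summits.AtomisticToContinuum.Crystallization.Theorems.IsometryAtomsMinimisingLawsHaveAtomsHcpStepConnected
import Summits.AtomisticToContinuum.Crystallization.Theorems.IsometryAtomsMinimisingLawsHaveAtomsHcpCovering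
import Summits.AtomisticToContinuum.Crystallization.Theorems.IsometryAtomsMinimisingLawsHaveAtomsLocallyRigidOf

/-!
# `IsometryAtoms.MinimisingLawsHaveAtoms` (stmt-AtomisticToContinuum-15776) from ONE dual object:
# a strict Mecke calibration at the relaxed-hcp template (line `IdeatorOneSketch`,
# idea `strict-calibration-exactness`) — the sorry-free part of the line, landed as `--supports`

Everything of the line except its content stub, as def-free theorems over tree vocabulary:

* `ae_exactEnv_of_strictCalibration` — FIRST LEMMA (exact complementary slackness): a jointly
  measurable, bounded, finite-hop bond transfer `t` with weak duality `e* ≤ h + div t` on every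
  rooted `δ`-hard-core configuration, and strictness "equality ⇒ the root's closed `R₀`-ball is that
  of a rooted isometric copy `A(Y − q)` of the template `Y`", makes every minimising
  (`E_P[h] ≤ e*`) point-stationary `δ`-hard-core probability law almost surely exact at radius
  `R₀`. Proof: the landed Mecke pricing `MeckePricing.stub_meckePricing_unfolded` priced with the
  events `{h + div t < e* + 1/(n+1)}` gives `P*` of their complements `= 0`; so a.s.
  `h + div t ≤ e*`, weak duality gives equality, strictness the exact environment.
* `ae_rooted_of_ae_exactEnv` — SECOND LEMMA: if `Y` is locally rigid at radius `R₀` (a point set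
  `S ∋ 0` all of whose points see exactly a rooted copy of `Y` inside `B̄(0, R₀)` IS a rooted copy),
  then a.s.-exactness of the root gives: a.s. the configuration is `count|A(Y − q)`. Proof:
  a.s. hard-core configurations are locally finite, so "everything shows at the root"
  (`PalmUnimodularRigidity.ae_forall_map_sub_of_ae`) moves exactness to every point
  (`map_sub_count_restrict`), and local rigidity concludes.
* `locallyRigid_hcpStacking` — the EXACT LOCAL THEOREM for relaxed hcp at radius `11a/5`,
  `h/a ∈ [39/50, 17/20]`: from the landed generic local theorem `stub_locallyRigid_of` fed with the
  landed hcp facts `stub_hcpPatchRigid` (the stabiliser of the 13-point first-shell patch is the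
  site group), `stub_hcpStepConnected`, `stub_hcpCovering` and `hcpStacking_homogeneous`.
* `minimisingLawsHaveAtoms_of_strictCalibrationHcp` — THE REDUCTION: the registered content stub
  `stub_strictCalibrationHcp` of the line (for every `δ > 0` a strict calibration at some box
  template `hcpStacking a h`, exact at radius `11a/5`), taken as a hypothesis VERBATIM, implies the
  crux: the charged class is that of `hcpStacking a h`, with full mass. CONDITIONAL — it does not
  close stmt-15776; the hypothesis contains the optimality of relaxed hcp for `V_LJ`
  (Blanc–Lewin 2015 §2.3: open in `d = 3`).
-/

noncomputable section

open MeasureTheory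
open Literature.Probability.Process (IsPointStationaryLaw IsRootedHardCore map_sub_count_restrict
  count_restrict_singleton_ne_zero_iff)
open Literature.MathematicalPhysics.StatisticalMechanics (lennardJones rootEnergy PeriodicConfiguration
  hcpStacking hcpStacking_homogeneous barlowPos haggLabel_zero)

namespace Summit.AtomisticToContinuum.Crystallization.Theorems.IsometryAtomsMinimisingLawsHaveAtoms

/-- **First lemma of line `IdeatorOneSketch` (exact complementary slackness in the Palm LP).**
A strict Mecke calibration `t` at template `Y` (jointly measurable, `|t| ≤ M`, `t μ y = 0` for
`‖y‖ > R`; weak duality `e* ≤ h(μ) + div t(μ)` on every rooted `δ`-hard-core `μ`, where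
`div t(μ) = ∫ (t μ y − t (θ_y μ) (−y)) dμ(y)`; strictness: equality forces
`μ|B̄(0,R₀) = (count|A(Y − q))|B̄(0,R₀)` for some linear isometry `A` and `q ∈ Y`) makes every
point-stationary probability law that is a.s. `δ`-hard-core and minimising (`E_P[h] ≤ e*`) almost
surely exact at radius `R₀`. Corollary of the landed Mecke pricing theorem
`PalmUnimodularRigidityMinimiserShells.MeckePricing.stub_meckePricing_unfolded`. -/
theorem ae_exactEnv_of_strictCalibration (δ R₀ : ℝ) (hδ : 0 < δ)
    (Y : Set (EuclideanSpace ℝ (Fin 3))) (R M : ℝ)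
    (t : Measure (EuclideanSpace ℝ (Fin 3)) → EuclideanSpace ℝ (Fin 3) → ℝ)
    (ht : Measurable (Function.uncurry t)) (hM : ∀ μ y, |t μ y| ≤ M)
    (hR : ∀ μ y, R < ‖y‖ → t μ y = 0)
    (hweak : ∀ μ : Measure (EuclideanSpace ℝ (Fin 3)), IsRootedHardCore δ μ →
      (⨅ Q : PeriodicConfiguration 3, Q.energyPerParticle lennardJones) ≤
        rootEnergy lennardJones μ + ∫ y, (t μ y - t (Measure.map (fun z => z - y) μ) (-y)) ∂μ)
    (hstrict : ∀ μ : Measure (EuclideanSpace ℝ (Fin 3)), IsRootedHardCore δ μ →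
      rootEnergy lennardJones μ + ∫ y, (t μ y - t (Measure.map (fun z => z - y) μ) (-y)) ∂μ =
        (⨅ Q : PeriodicConfiguration 3, Q.energyPerParticle lennardJones) →
      ∃ ν ∈ {μ : Measure (EuclideanSpace ℝ (Fin 3)) |
          ∃ A : EuclideanSpace ℝ (Fin 3) →ₗᵢ[ℝ] EuclideanSpace ℝ (Fin 3), ∃ q ∈ Y,
            μ = (Measure.count : Measure (EuclideanSpace ℝ (Fin 3))).restrict
              ((fun s => A (s - q)) '' Y)},
        μ.restrict (Metric.closedBall (0 : EuclideanSpace ℝ (Fin 3)) R₀) =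
          ν.restrict (Metric.closedBall (0 : EuclideanSpace ℝ (Fin 3)) R₀))
    (P : Measure (Measure (EuclideanSpace ℝ (Fin 3)))) [IsProbabilityMeasure P]
    (hhc : ∀ᵐ μ ∂P, IsRootedHardCore δ μ) (hst : IsPointStationaryLaw P)
    (hE : (∫ μ, rootEnergy lennardJones μ ∂P) ≤
      ⨅ Q : PeriodicConfiguration 3, Q.energyPerParticle lennardJones) :
    ∀ᵐ μ ∂P, ∃ ν ∈ {μ : Measure (EuclideanSpace ℝ (Fin 3)) |
          ∃ A : EuclideanSpace ℝ (Fin 3) →ₗᵢ[ℝ] EuclideanSpace ℝ (Fin 3), ∃ q ∈ Y,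
            μ = (Measure.count : Measure (EuclideanSpace ℝ (Fin 3))).restrict
              ((fun s => A (s - q)) '' Y)},
        μ.restrict (Metric.closedBall (0 : EuclideanSpace ℝ (Fin 3)) R₀) =
          ν.restrict (Metric.closedBall (0 : EuclideanSpace ℝ (Fin 3)) R₀) := by
  set e : ℝ := ⨅ Q : PeriodicConfiguration 3, Q.energyPerParticle lennardJones with he
  have hmean :
      Summit.AtomisticToContinuum.Crystallization.Theorems.MinimiserShells.Negative.LoadBearing.meanRootEnergy
        P ≤ e := hE
  have key : ∀ n : ℕ, ∀ᵐ μ ∂P, rootEnergy lennardJones μ +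
      ∫ y, (t μ y - t (Measure.map (fun z => z - y) μ) (-y)) ∂μ < e + 1 / ((n : ℝ) + 1) := by
    intro n
    have hc₀ : (0 : ℝ) ≤ 1 / ((n : ℝ) + 1) := by positivity
    have hpos : (0 : ℝ) < 1 / ((n : ℝ) + 1) := by positivity
    have hpr :=
      Summit.AtomisticToContinuum.Crystallization.Theorems.PalmUnimodularRigidityMinimiserShells.MeckePricing.stub_meckePricing_unfolded
        δ hδ P ‹_› hhc hst R M t ⟨ht, hM, hR⟩
        (fun μ => rootEnergy lennardJones μ +
          ∫ y, (t μ y - t (Measure.map (fun z => z - y) μ) (-y)) ∂μ < e + 1 / ((n : ℝ) + 1))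
        e (1 / ((n : ℝ) + 1)) hc₀
        (fun μ hμ => ⟨hweak μ hμ, fun hG => not_lt.1 hG⟩)
    have hnn : 0 ≤ (P {μ | ¬ (rootEnergy lennardJones μ +
        ∫ y, (t μ y - t (Measure.map (fun z => z - y) μ) (-y)) ∂μ <
          e + 1 / ((n : ℝ) + 1))}).toReal := ENNReal.toReal_nonneg
    have hzero : (P {μ | ¬ (rootEnergy lennardJones μ +
        ∫ y, (t μ y - t (Measure.map (fun z => z - y) μ) (-y)) ∂μ <
          e + 1 / ((n : ℝ) + 1))}).toReal = 0 :=
      le_antisymm (by nlinarith [mul_nonneg hpos.le hnn]) hnn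
    have hnull : P {μ | ¬ (rootEnergy lennardJones μ +
        ∫ y, (t μ y - t (Measure.map (fun z => z - y) μ) (-y)) ∂μ <
          e + 1 / ((n : ℝ) + 1))} = 0 := by
      rcases (ENNReal.toReal_eq_zero_iff _).1 hzero with h0 | htop
      · exact h0
      · exact absurd htop (measure_ne_top P _)
    rw [ae_iff]
    exact hnull
  have hall : ∀ᵐ μ ∂P, ∀ n : ℕ, rootEnergy lennardJones μ +
      ∫ y, (t μ y - t (Measure.map (fun z => z - y) μ) (-y)) ∂μ < e + 1 / ((n : ℝ) + 1) :=
    ae_all_iff.2 key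
  filter_upwards [hall, hhc] with μ hμ hμhc
  have hle : rootEnergy lennardJones μ +
      ∫ y, (t μ y - t (Measure.map (fun z => z - y) μ) (-y)) ∂μ ≤ e := by
    refine le_of_forall_pos_lt_add fun ε hε => ?_
    obtain ⟨n, hn⟩ := exists_nat_one_div_lt hε
    calc rootEnergy lennardJones μ +
          ∫ y, (t μ y - t (Measure.map (fun z => z - y) μ) (-y)) ∂μ < e + 1 / ((n : ℝ) + 1) :=
        hμ n
      _ < e + ε := by linarith
  exact hstrict μ hμhc (le_antisymm hle (hweak μ hμhc))

/-- **Second lemma of line `IdeatorOneSketch` ("root a.s. exact ⇒ a.s. a rooted copy").** If the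
template `Y` is LOCALLY RIGID at radius `R₀` — every point set `S ∋ 0` all of whose points `x`
satisfy `(count|(S − x))|B̄(0,R₀) = (count|A(Y − q))|B̄(0,R₀)` for some linear isometry `A` and
`q ∈ Y` is itself `count|S = count|A(Y − q)` — then under a point-stationary probability law,
a.s. `δ`-hard-core, a.s.-exactness of the ROOT at radius `R₀` already gives: a.s. the
configuration is a rooted isometric copy of `Y`. Uses the landed "everything shows at the root"
(`PalmUnimodularRigidity.ae_forall_map_sub_of_ae`) on locally finite hard-core configurations.
[folklore; AldousLyons2007 §2] -/
theorem ae_rooted_of_ae_exactEnv (δ R₀ : ℝ) (hδ : 0 < δ) (Y : Set (EuclideanSpace ℝ (Fin 3)))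
    (hrig : ∀ S : Set (EuclideanSpace ℝ (Fin 3)), (0 : EuclideanSpace ℝ (Fin 3)) ∈ S →
      (∀ x ∈ S, ∃ ν ∈ {μ : Measure (EuclideanSpace ℝ (Fin 3)) |
          ∃ A : EuclideanSpace ℝ (Fin 3) →ₗᵢ[ℝ] EuclideanSpace ℝ (Fin 3), ∃ q ∈ Y,
            μ = (Measure.count : Measure (EuclideanSpace ℝ (Fin 3))).restrict
              ((fun s => A (s - q)) '' Y)},
        ((Measure.count : Measure (EuclideanSpace ℝ (Fin 3))).restrict
            ((fun s => s - x) '' S)).restrict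
            (Metric.closedBall (0 : EuclideanSpace ℝ (Fin 3)) R₀) =
          ν.restrict (Metric.closedBall (0 : EuclideanSpace ℝ (Fin 3)) R₀)) →
      (Measure.count : Measure (EuclideanSpace ℝ (Fin 3))).restrict S ∈
        {μ : Measure (EuclideanSpace ℝ (Fin 3)) |
          ∃ A : EuclideanSpace ℝ (Fin 3) →ₗᵢ[ℝ] EuclideanSpace ℝ (Fin 3), ∃ q ∈ Y,
            μ = (Measure.count : Measure (EuclideanSpace ℝ (Fin 3))).restrict
              ((fun s => A (s - q)) '' Y)})
    (P : Measure (Measure (EuclideanSpace ℝ (Fin 3)))) [IsProbabilityMeasure P]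
    (hhc : ∀ᵐ μ ∂P, IsRootedHardCore δ μ) (hst : IsPointStationaryLaw P)
    (hex : ∀ᵐ μ ∂P, ∃ ν ∈ {μ : Measure (EuclideanSpace ℝ (Fin 3)) |
          ∃ A : EuclideanSpace ℝ (Fin 3) →ₗᵢ[ℝ] EuclideanSpace ℝ (Fin 3), ∃ q ∈ Y,
            μ = (Measure.count : Measure (EuclideanSpace ℝ (Fin 3))).restrict
              ((fun s => A (s - q)) '' Y)},
        μ.restrict (Metric.closedBall (0 : EuclideanSpace ℝ (Fin 3)) R₀) =
          ν.restrict (Metric.closedBall (0 : EuclideanSpace ℝ (Fin 3)) R₀)) :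
    ∀ᵐ μ ∂P, μ ∈ {μ : Measure (EuclideanSpace ℝ (Fin 3)) |
          ∃ A : EuclideanSpace ℝ (Fin 3) →ₗᵢ[ℝ] EuclideanSpace ℝ (Fin 3), ∃ q ∈ Y,
            μ = (Measure.count : Measure (EuclideanSpace ℝ (Fin 3))).restrict
              ((fun s => A (s - q)) '' Y)} := by
  have hlf : ∀ᵐ μ ∂P, ∀ n : ℕ, μ ((fun z : EuclideanSpace ℝ (Fin 3) => ⌊‖z‖⌋₊) ⁻¹' {n}) < ⊤ := by
    filter_upwards [hhc] with μ hμ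
    obtain ⟨S, -, hsep, rfl⟩ := hμ
    exact fun n =>
      Summit.AtomisticToContinuum.Crystallization.Theorems.PalmUnimodularRigidity.count_restrict_floorNorm_preimage_lt_top
        hδ hsep n
  have hall :=
    Summit.AtomisticToContinuum.Crystallization.Theorems.PalmUnimodularRigidity.ae_forall_map_sub_of_ae
      hst hlf hex
  filter_upwards [hall, hhc] with μ hμ hμhc
  obtain ⟨S, h0, hsep, rfl⟩ := hμhc
  refine hrig S h0 fun x hx => ?_
  have hx' : (Measure.count : Measure (EuclideanSpace ℝ (Fin 3))).restrict S {x} ≠ 0 :=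
    (count_restrict_singleton_ne_zero_iff S x).2 hx
  have h1 := hμ x hx'
  rwa [map_sub_count_restrict] at h1

/-- **Exact local theorem for relaxed hcp at radius `11a/5`** (`0 < a`, `h/a ∈ [39/50, 17/20]`):
a point set `S ∋ 0` every point `x` of which sees, inside the closed `11a/5`-ball, EXACTLY a rooted
isometric copy of `hcpStacking a h` around it — `(count|(S − x))|B̄ = (count|A(hcp − q))|B̄` — is
itself such a rooted copy. From the landed generic local theorem `stub_locallyRigid_of`
(`R₁ = 23a/20`, `ρ = 21a/20`) and the landed hcp facts `stub_hcpPatchRigid` (the linear setwise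
stabiliser of the 13-point first-shell patch preserves the stacking), `stub_hcpStepConnected`,
`stub_hcpCovering`, `hcpStacking_homogeneous`. [folklore; the local theorem of
Delone–Dolbilin–Shtogrin–Galiulin specialised to hcp] -/
theorem locallyRigid_hcpStacking (a h : ℝ) (ha : 0 < a) (hh₁ : 39 / 50 * a ≤ h)
    (hh₂ : h ≤ 17 / 20 * a) :
    ∀ S : Set (EuclideanSpace ℝ (Fin 3)), (0 : EuclideanSpace ℝ (Fin 3)) ∈ S →
      (∀ x ∈ S, ∃ ν ∈ {μ : Measure (EuclideanSpace ℝ (Fin 3)) |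
          ∃ A : EuclideanSpace ℝ (Fin 3) →ₗᵢ[ℝ] EuclideanSpace ℝ (Fin 3), ∃ q ∈ hcpStacking a h,
            μ = (Measure.count : Measure (EuclideanSpace ℝ (Fin 3))).restrict
              ((fun s => A (s - q)) '' hcpStacking a h)},
        ((Measure.count : Measure (EuclideanSpace ℝ (Fin 3))).restrict
            ((fun s => s - x) '' S)).restrict
            (Metric.closedBall (0 : EuclideanSpace ℝ (Fin 3)) (11 / 5 * a)) =
          ν.restrict (Metric.closedBall (0 : EuclideanSpace ℝ (Fin 3)) (11 / 5 * a))) →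
      (Measure.count : Measure (EuclideanSpace ℝ (Fin 3))).restrict S ∈
        {μ : Measure (EuclideanSpace ℝ (Fin 3)) |
          ∃ A : EuclideanSpace ℝ (Fin 3) →ₗᵢ[ℝ] EuclideanSpace ℝ (Fin 3), ∃ q ∈ hcpStacking a h,
            μ = (Measure.count : Measure (EuclideanSpace ℝ (Fin 3))).restrict
              ((fun s => A (s - q)) '' hcpStacking a h)} := by
  intro S h0 hS
  exact stub_locallyRigid_of (hcpStacking a h) (11 / 5 * a) (23 / 20 * a) (21 / 20 * a)
    (by positivity) (by positivity) (by linarith)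
    (show (0 : EuclideanSpace ℝ (Fin 3)) ∈ hcpStacking a h from ⟨0, 0, 0, by simp [barlowPos]⟩)
    (fun p hp => hcpStacking_homogeneous a h hp)
    (stub_hcpPatchRigid a h ha hh₁ hh₂) (stub_hcpStepConnected a h ha hh₁ hh₂)
    (stub_hcpCovering a h ha hh₁ hh₂) S h0 hS

/-- **The reduction of the crux to ONE dual object** (line `IdeatorOneSketch`, CONDITIONAL): the
registered content stub `stub_strictCalibrationHcp` — for every hard core `δ > 0` a strict
finite-hop Mecke calibration at some box template `hcpStacking a h` (`0 < a`,
`h/a ∈ [39/50, 17/20]`), exact at radius `11a/5` — taken VERBATIM as hypothesis, implies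
`IsometryAtoms.MinimisingLawsHaveAtoms`: the law charges the rooted isometry class of
`hcpStacking a h` with full mass (first lemma ⇒ a.s. exact at `11a/5`; exact local theorem for hcp
+ second lemma ⇒ a.s. a rooted copy; outer measure of the class `= 1 > 0`). Does NOT close
stmt-15776: the hypothesis contains the optimality of relaxed hcp for `V_LJ` (open in `d = 3`,
Blanc–Lewin 2015 §2.3). -/
theorem minimisingLawsHaveAtoms_of_strictCalibrationHcp :
    (∀ δ : ℝ, 0 < δ → ∃ a h : ℝ, 0 < a ∧ 39 / 50 * a ≤ h ∧ h ≤ 17 / 20 * a ∧ ∃ (R M : ℝ) (t : MeasureTheory.Measure (EuclideanSpace ℝ (Fin 3)) → EuclideanSpace ℝ (Fin 3) → ℝ), Measurable (Function.uncurry t) ∧ (∀ μ y, |t μ y| ≤ M) ∧ (∀ μ y, R < ‖y‖ → t μ y = 0) ∧ (∀ μ : MeasureTheory.Measure (EuclideanSpace ℝ (Fin 3)), Literature.Probability.Process.IsRootedHardCore δ μ → (⨅ Q : Literature.MathematicalPhysics.StatisticalMechanics.PeriodicConfiguration 3, Q.energyPerParticle Literature.MathematicalPhysics.StatisticalMechanics.lennardJones)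 ≤ Literature.MathematicalPhysics.StatisticalMechanics.rootEnergy Literature.MathematicalPhysics.StatisticalMechanics.lennardJones μ + ∫ y, (t μ y - t (MeasureTheory.Measure.map (fun z => z - y) μ) (-y)) ∂μ) ∧ (∀ μ : MeasureTheory.Measure (EuclideanSpace ℝ (Fin 3)), Literature.Probability.Process.IsRootedHardCore δ μ → Literature.MathematicalPhysics.StatisticalMechanics.rootEnergy Literature.MathematicalPhysics.StatisticalMechanics.lennardJones μ + ∫ y, (t μ y - t (MeasureTheory.Measure.map (fun z => z - y) μ) (-y)) ∂μ = (⨅ Q : Literature.MathematicalPhysics.StatisticalMechanics.PeriodicConfiguration 3, Q.energyPerParticle Literature.MathematicalPhysics.StatisticalMechanics.lennardJones) → ∃ ν ∈ {μ : MeasureTheory.Measure (EuclideanSpace ℝ (Fin 3)) | ∃ A : EuclideanSpace ℝ (Fin 3) →ₗᵢ[ℝ] EuclideanSpace ℝ (Fin 3), ∃ q ∈ Literature.MathematicalPhysics.StatisticalMechanics.hcpStacking a h, μ = (MeasureTheory.Measure.count : MeasureTheory.Measure (EuclideanSpace ℝ (Fin 3))).restrict ((fun s => A (s - q)) '' Literature.MathematicalPhysics.StatisticalMechanics.hcpStacking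 a h)}, μ.restrict (Metric.closedBall (0 : EuclideanSpace ℝ (Fin 3)) (11 / 5 * a)) = ν.restrict (Metric.closedBall (0 : EuclideanSpace ℝ (Fin 3)) (11 / 5 * a)))) → Summit.AtomisticToContinuum.Crystallization.Theses.IsometryAtoms.MinimisingLawsHaveAtoms := by
  intro hcal δ hδ P hP hhc hst hE
  obtain ⟨a, h, ha, hh₁, hh₂, R, M, t, ht, hM, hR, hweak, hstrict⟩ := hcal δ hδ
  refine ⟨hcpStacking a h, ?_⟩
  have hae : ∀ᵐ μ ∂P, μ ∈ {μ : Measure (EuclideanSpace ℝ (Fin 3)) |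
          ∃ A : EuclideanSpace ℝ (Fin 3) →ₗᵢ[ℝ] EuclideanSpace ℝ (Fin 3), ∃ q ∈ hcpStacking a h,
            μ = (Measure.count : Measure (EuclideanSpace ℝ (Fin 3))).restrict
              ((fun s => A (s - q)) '' hcpStacking a h)} :=
    ae_rooted_of_ae_exactEnv δ (11 / 5 * a) hδ (hcpStacking a h)
      (locallyRigid_hcpStacking a h ha hh₁ hh₂) P hhc hst
      (ae_exactEnv_of_strictCalibration δ (11 / 5 * a) hδ (hcpStacking a h) R M t ht hM hR hweak
        hstrict P hhc hst hE)
  set C : Set (Measure (EuclideanSpace ℝ (Fin 3))) := {μ : Measure (EuclideanSpace ℝ (Fin 3)) |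
          ∃ A : EuclideanSpace ℝ (Fin 3) →ₗᵢ[ℝ] EuclideanSpace ℝ (Fin 3), ∃ q ∈ hcpStacking a h,
            μ = (Measure.count : Measure (EuclideanSpace ℝ (Fin 3))).restrict
              ((fun s => A (s - q)) '' hcpStacking a h)} with hC
  change 0 < P C
  have h0 : P Cᶜ = 0 := by
    rw [ae_iff] at hae
    simpa [Set.compl_def] using hae
  have h1' : (1 : ENNReal) ≤ P C := by
    calc (1 : ENNReal) = P Set.univ := measure_univ.symm
      _ = P (C ∪ Cᶜ) := by rw [Set.union_compl_self]
      _ ≤ P C + P Cᶜ := measure_union_le _ _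
      _ = P C := by rw [h0, add_zero]
  exact lt_of_lt_of_le one_pos h1'

end Summit.AtomisticToContinuum.Crystallization.Theorems.IsometryAtomsMinimisingLawsHaveAtoms

end
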